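import Summits.MatrixMultiplication.MatrixMultiplication.Theses.SnSubsetDichotomy
import Literature.NumberTheory.DiophantineGeometry.PartitionTableaux
import Literature.NumberTheory.DiophantineGeometry.SymmetricGroupReps
import Literature.RepresentationTheory.FiniteGroups.WedderburnBlocks
import Literature.RepresentationTheory.FiniteGroups.UnitaryWedderburn
import Literature.RepresentationTheory.FiniteGroups.FourierInversionIdentity
import Literature.Combinatorics.Additive.TPPGroupAlgebra
import Literature.Barriers.MatrixMultiplication.QuasirandomBarrierProofs

/-!
# Stub `stub_blockTruncation` (crux stmt-MatrixMultiplication-8303, line flat-tail-truncation)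

Crux `Summit.MatrixMultiplication.MatrixMultiplication.Theses.SnSubsetDichotomy.GlobalBranch`, line
`flat-tail-truncation`: the group-agnostic analytic core of the two-ended truncated count.

For a finite group `G`, a unitary Wedderburn decomposition `φ : ℂ[G] ≃ₐ ∏ᵢ ℂ^{dᵢ×dᵢ}`, a labelling
`lab` of the blocks by `0, …, M`, a threshold `D > 0` with `dᵢ = 1 ∨ D ≤ dᵢ` on the label-`0`
blocks, dimension bounds `dᵢ ≤ N m` and Hilbert–Schmidt mass bounds
`Σ_{lab i = m} ‖φ(𝟙_X)ᵢ‖²_F ≤ |X|² F m X` on the label-`m` families (`m ≥ 1`), and a TPP triple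
`S, T, U` with `V = |S||T||U|`, we prove
`V² ≤ |G| V + |G|^{3/2} V / √D + V² Σ_{m=1}^{M} N m · F m S · F m T · F m U`.

This is the proof of BCGPU 2023, Thm. 3.2 of the tree
(`Literature.Barriers.MatrixMultiplication.BCGPU2023_thm32_holds`) with the blocks of dimension
`> 1` split by the label: Fourier inversion at `1` (`card_mul_coeff_one_eq_sum_trace`) and the TPP
count (`TripleProductProperty.coeff_one_six`) give `|G| V = Σᵢ dᵢ Re tr(Aᵢ Bᵢ Cᵢ)` with
`Aᵢ = φ(𝟙_S)ᵢᴴ φ(𝟙_T)ᵢ`, `Bᵢ = φ(𝟙_T)ᵢᴴ φ(𝟙_U)ᵢ`, `Cᵢ = φ(𝟙_U)ᵢᴴ φ(𝟙_S)ᵢ`; blocks with `dᵢ = 1`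
contribute non-negative reals (`trace_cyclic_nonneg_of_subsingleton`) and the trivial block
(`exists_trivial_block`) contributes `V²`; label-`0` blocks with `dᵢ ≥ D` are bounded through
Parseval (`parseval_of_adjoint`, `TripleProductProperty.coeff_one_four`), `|tr(ABC)| ≤ ‖A‖‖B‖‖C‖`
(`norm_trace_mul_mul_le`) and Cauchy–Schwarz over `i` (`Real.sum_sqrt_mul_sqrt_le`) by
`V |G|^{3/2}/√D`; label-`m` blocks are bounded by `N m ‖φ(𝟙_S)ᵢ‖² ‖φ(𝟙_T)ᵢ‖² ‖φ(𝟙_U)ᵢ‖²`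
(`re_trace_conjTranspose_mul_self_mul_le`) and summed family-wise.
-/

set_option linter.dupNamespace false

open scoped BigOperators Matrix ComplexOrder
open Finset
open Literature.Combinatorics.Additive (TripleProductProperty indicatorElem indicatorElemInv)
open Literature.NumberTheory.DiophantineGeometry (numStandardTableaux spechtCharacter)
open Literature.RepresentationTheory.FiniteGroups (BlockAlgebraC blockRep)

namespace Summit.MatrixMultiplication.MatrixMultiplication.Theorems.GlobalBranch

open Literature.Combinatorics.Additive Literature.RepresentationTheory.FiniteGroups
  Literature.Barriers.MatrixMultiplication

/-- For non-negative families on a finite set, `Σᵢ xᵢ yᵢ zᵢ ≤ (Σ x)(Σ y)(Σ z)`. [folklore] -/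
theorem stub_blockTruncation_sum_mul_mul_le {ι : Type*} (s : Finset ι) (x y z : ι → ℝ)
    (hx : ∀ i ∈ s, 0 ≤ x i) (hy : ∀ i ∈ s, 0 ≤ y i) (hz : ∀ i ∈ s, 0 ≤ z i) :
    ∑ i ∈ s, x i * y i * z i ≤ (∑ i ∈ s, x i) * (∑ i ∈ s, y i) * (∑ i ∈ s, z i) := by
  calc ∑ i ∈ s, x i * y i * z i ≤ ∑ i ∈ s, x i * (∑ j ∈ s, y j) * (∑ j ∈ s, z j) :=
        Finset.sum_le_sum fun i hi =>
          mul_le_mul (mul_le_mul_of_nonneg_left (Finset.single_le_sum hy hi) (hx i hi))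
            (Finset.single_le_sum hz hi) (hz i hi) (mul_nonneg (hx i hi) (Finset.sum_nonneg hy))
    _ = (∑ i ∈ s, x i) * (∑ i ∈ s, y i) * (∑ i ∈ s, z i) := by
        rw [Finset.sum_mul, Finset.sum_mul]

/-- **Two-ended block truncation of the BCGPU identity** (the level-`L` form of BCGPU 2023,
Thm. 3.2, for any finite group and any unitary Wedderburn decomposition): with `V = |S||T||U|` for a
TPP triple, a labelling `lab` of the blocks into the positivity/high family (label `0`:
`dᵢ = 1 ∨ D ≤ dᵢ`) and low families `m = 1, …, M` (`dᵢ ≤ N m`, family Hilbert–Schmidt masses of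
`φ(𝟙_X)` at most `|X|² F m X`),
`V² ≤ |G| V + |G|^{3/2} V/√D + V² Σ_{m=1}^{M} N m F m S F m T F m U`. -/
theorem stub_blockTruncation {G : Type} [Group G] [Fintype G] [DecidableEq G]
    {r : ℕ} {d : Fin r → ℕ} [∀ i, NeZero (d i)]
    (φ : MonoidAlgebra ℂ G ≃ₐ[ℂ] BlockAlgebraC d)
    (hφ : ∀ (g : G) (i : Fin r),
      (φ (MonoidAlgebra.single g 1) i)ᴴ * φ (MonoidAlgebra.single g 1) i = 1)
    (M : ℕ) (lab : Fin r → ℕ) (hlab : ∀ i, lab i ≤ M)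
    (D : ℝ) (hD : 0 < D) (h0 : ∀ i, lab i = 0 → d i = 1 ∨ D ≤ (d i : ℝ))
    (N : ℕ → ℝ) (hN0 : ∀ m, 0 ≤ N m) (hN : ∀ i, lab i ≠ 0 → (d i : ℝ) ≤ N (lab i))
    (F : ℕ → Finset G → ℝ) (hF0 : ∀ m X, 0 ≤ F m X)
    (hF : ∀ m : ℕ, m ≠ 0 → ∀ X : Finset G,
      ∑ i ∈ univ.filter (fun i => lab i = m),
        ((φ (indicatorElem ℂ X) i)ᴴ * φ (indicatorElem ℂ X) i).trace.re ≤ (X.card : ℝ) ^ 2 * F m X)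
    (S T U : Finset G) (hTPP : TripleProductProperty S T U) :
    ((S.card * T.card * U.card : ℕ) : ℝ) ^ 2 ≤
      (Fintype.card G : ℝ) * ((S.card * T.card * U.card : ℕ) : ℝ) +
        (Fintype.card G : ℝ) ^ ((3 : ℝ) / 2) * ((S.card * T.card * U.card : ℕ) : ℝ) / Real.sqrt D +
        ((S.card * T.card * U.card : ℕ) : ℝ) ^ 2 *
          ∑ m ∈ Finset.Ico 1 (M + 1), N m * (F m S * F m T * F m U) := by
  -- degenerate case: one of the sets is empty
  by_cases hV0 : S.card * T.card * U.card = 0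
  · rw [hV0, Nat.cast_zero]
    simp
  have hS : S.Nonempty := Finset.card_ne_zero.1 fun h => hV0 (by simp [h])
  have hT : T.Nonempty := Finset.card_ne_zero.1 fun h => hV0 (by simp [h])
  have hU : U.Nonempty := Finset.card_ne_zero.1 fun h => hV0 (by simp [h])
  -- the trivial block
  obtain ⟨i₀, hdi₀, hφi₀⟩ := exists_trivial_block φ
  -- notation
  set V : ℕ := S.card * T.card * U.card with hV
  set cG : ℝ := (Fintype.card G : ℝ) with hcG
  set a : ∀ i : Fin r, Matrix (Fin (d i)) (Fin (d i)) ℂ := fun i => φ (indicatorElem ℂ S) i with ha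
  set t : ∀ i : Fin r, Matrix (Fin (d i)) (Fin (d i)) ℂ := fun i => φ (indicatorElem ℂ T) i with ht
  set u : ∀ i : Fin r, Matrix (Fin (d i)) (Fin (d i)) ℂ := fun i => φ (indicatorElem ℂ U) i with hu
  set A : ∀ i : Fin r, Matrix (Fin (d i)) (Fin (d i)) ℂ := fun i => (a i)ᴴ * t i with hA
  set B : ∀ i : Fin r, Matrix (Fin (d i)) (Fin (d i)) ℂ := fun i => (t i)ᴴ * u i with hB
  set C : ∀ i : Fin r, Matrix (Fin (d i)) (Fin (d i)) ℂ := fun i => (u i)ᴴ * a i with hC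
  have hPA : ∀ i, φ (indicatorElemInv ℂ S * indicatorElem ℂ T) i = A i := fun i => by
    rw [map_mul, Pi.mul_apply, algEquiv_indicatorElemInv_eq_conjTranspose φ hφ]
  have hQB : ∀ i, φ (indicatorElemInv ℂ T * indicatorElem ℂ U) i = B i := fun i => by
    rw [map_mul, Pi.mul_apply, algEquiv_indicatorElemInv_eq_conjTranspose φ hφ]
  have hRC : ∀ i, φ (indicatorElemInv ℂ U * indicatorElem ℂ S) i = C i := fun i => by
    rw [map_mul, Pi.mul_apply, algEquiv_indicatorElemInv_eq_conjTranspose φ hφ]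
  -- (1) Fourier inversion at `1` + TPP count: `|G| V = ∑ dᵢ tr(Aᵢ Bᵢ Cᵢ)`
  have h1 : (cG * V : ℝ) = ∑ i, (d i : ℝ) * (A i * B i * C i).trace.re := by
    have h := card_mul_coeff_one_eq_sum_trace φ
      ((indicatorElemInv ℂ S * indicatorElem ℂ T) * (indicatorElemInv ℂ T * indicatorElem ℂ U) *
        (indicatorElemInv ℂ U * indicatorElem ℂ S))
    rw [hTPP.coeff_one_six] at h
    simp only [map_mul, Pi.mul_apply] at h
    simp only [map_mul, Pi.mul_apply] at hPA hQB hRC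
    simp only [hPA, hQB, hRC] at h
    have h' := congrArg Complex.re h
    rw [Complex.re_sum] at h'
    simpa [hcG, hV] using h'
  -- (2) Parseval: `∑ dᵢ ‖Aᵢ‖² = |G||S||T|` and cyclically
  have h2A : ∑ i, (d i : ℝ) * ((A i)ᴴ * A i).trace.re = cG * (S.card * T.card) := by
    have h := parseval_of_adjoint φ (indicatorElemInv ℂ S * indicatorElem ℂ T)
      (indicatorElemInv ℂ T * indicatorElem ℂ S) fun i => by
      rw [hPA, map_mul, Pi.mul_apply, algEquiv_indicatorElemInv_eq_conjTranspose φ hφ, hA]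
      simp only [Matrix.conjTranspose_mul, Matrix.conjTranspose_conjTranspose]
      rfl
    rw [hTPP.coeff_one_four hU] at h
    simp only [hPA] at h
    rw [hcG]
    exact_mod_cast h
  have h2B : ∑ i, (d i : ℝ) * ((B i)ᴴ * B i).trace.re = cG * (T.card * U.card) := by
    have h := parseval_of_adjoint φ (indicatorElemInv ℂ T * indicatorElem ℂ U)
      (indicatorElemInv ℂ U * indicatorElem ℂ T) fun i => by
      rw [hQB, map_mul, Pi.mul_apply, algEquiv_indicatorElemInv_eq_conjTranspose φ hφ, hB]
      simp only [Matrix.conjTranspose_mul, Matrix.conjTranspose_conjTranspose]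
      rfl
    rw [hTPP.rotate.coeff_one_four hS] at h
    simp only [hQB] at h
    rw [hcG]
    exact_mod_cast h
  have h2C : ∑ i, (d i : ℝ) * ((C i)ᴴ * C i).trace.re = cG * (U.card * S.card) := by
    have h := parseval_of_adjoint φ (indicatorElemInv ℂ U * indicatorElem ℂ S)
      (indicatorElemInv ℂ S * indicatorElem ℂ U) fun i => by
      rw [hRC, map_mul, Pi.mul_apply, algEquiv_indicatorElemInv_eq_conjTranspose φ hφ, hC]
      simp only [Matrix.conjTranspose_mul, Matrix.conjTranspose_conjTranspose]
      rfl
    rw [hTPP.rotate.rotate.coeff_one_four hT] at h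
    simp only [hRC] at h
    rw [hcG]
    exact_mod_cast h
  -- (3) the trivial block contributes `V²`
  have hind : ∀ X : Finset G,
      φ (indicatorElem ℂ X) i₀ = (X.card : ℂ) • (1 : Matrix _ _ ℂ) := fun X => by
    rw [indicatorElem_def, map_sum, Finset.sum_apply]
    simp only [hφi₀, Finset.sum_const, Nat.cast_smul_eq_nsmul]
  have h3 : (d i₀ : ℝ) * (A i₀ * B i₀ * C i₀).trace.re = (V : ℝ) ^ 2 := by
    simp only [hA, hB, hC, ha, ht, hu, hind, Matrix.conjTranspose_smul, Matrix.conjTranspose_one,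
      Matrix.smul_mul, Matrix.mul_smul, Matrix.one_mul, smul_smul, Matrix.trace_smul,
      Matrix.trace_one, Fintype.card_fin, hdi₀, hV]
    simp only [Nat.cast_one, star_natCast, smul_eq_mul, mul_one, Complex.mul_re, Complex.natCast_re,
      Complex.natCast_im, mul_zero, sub_zero, Complex.mul_im, zero_mul, add_zero, one_mul,
      Nat.cast_mul]
    ring
  -- (4) blocks of dimension `1` contribute non-negative reals
  have h4 : ∀ i, d i = 1 → 0 ≤ (d i : ℝ) * (A i * B i * C i).trace.re := by
    intro i hi
    haveI : Subsingleton (Fin (d i)) := by rw [hi]; infer_instance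
    exact mul_nonneg (Nat.cast_nonneg _) (trace_cyclic_nonneg_of_subsingleton (a i) (t i) (u i))
  -- (5) HIGH blocks: dimension `≠ 1` and label `0`, hence `D ≤ dᵢ`
  set K : ℝ := Real.sqrt (cG * (S.card * T.card) / D) with hK
  have h5 : ∀ i, ¬ d i = 1 → lab i = 0 → (d i : ℝ) * ‖(A i * B i * C i).trace‖ ≤
      K * (Real.sqrt (d i * ((B i)ᴴ * B i).trace.re) *
        Real.sqrt (d i * ((C i)ᴴ * C i).trace.re)) := by
    intro i hi hli
    have hdi : (0 : ℝ) < d i := by exact_mod_cast Nat.pos_of_ne_zero (NeZero.ne (d i))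
    have hDle : D ≤ d i := (h0 i hli).resolve_left hi
    -- `‖Aᵢ‖² ≤ |G||S||T| / D`
    have hAi : ((A i)ᴴ * A i).trace.re ≤ cG * (S.card * T.card) / D := by
      have hle : (d i : ℝ) * ((A i)ᴴ * A i).trace.re ≤ cG * (S.card * T.card) := by
        rw [← h2A]
        exact Finset.single_le_sum (f := fun j => (d j : ℝ) * ((A j)ᴴ * A j).trace.re)
          (fun j _ => mul_nonneg (Nat.cast_nonneg _) (re_trace_conjTranspose_mul_self_nonneg _))
          (Finset.mem_univ i)
      calc ((A i)ᴴ * A i).trace.re ≤ cG * (S.card * T.card) / d i := by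
            rw [le_div_iff₀ hdi, mul_comm]; exact hle
        _ ≤ cG * (S.card * T.card) / D :=
            div_le_div_of_nonneg_left (by positivity) hD hDle
    calc (d i : ℝ) * ‖(A i * B i * C i).trace‖
        ≤ d i * (Real.sqrt (((A i)ᴴ * A i).trace.re) *
            (Real.sqrt (((B i)ᴴ * B i).trace.re) * Real.sqrt (((C i)ᴴ * C i).trace.re))) :=
          mul_le_mul_of_nonneg_left (norm_trace_mul_mul_le _ _ _) hdi.le
      _ ≤ d i * (K * (Real.sqrt (((B i)ᴴ * B i).trace.re) *
            Real.sqrt (((C i)ᴴ * C i).trace.re))) := by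
          gcongr
          exact Real.sqrt_le_sqrt hAi
      _ = K * (Real.sqrt (d i * ((B i)ᴴ * B i).trace.re) *
            Real.sqrt (d i * ((C i)ᴴ * C i).trace.re)) := by
          rw [Real.sqrt_mul hdi.le, Real.sqrt_mul hdi.le]
          have := Real.mul_self_sqrt hdi.le
          linear_combination
            (-(K * Real.sqrt (((B i)ᴴ * B i).trace.re) * Real.sqrt (((C i)ᴴ * C i).trace.re))) *
              this
  -- summing (5) over the high blocks, with Cauchy–Schwarz
  have h5sum : ∑ i ∈ (Finset.univ.filter (fun i => ¬ d i = 1)).filter (fun i => lab i = 0),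
      (d i : ℝ) * ‖(A i * B i * C i).trace‖ ≤
        K * (Real.sqrt (cG * (T.card * U.card)) * Real.sqrt (cG * (U.card * S.card))) := by
    calc ∑ i ∈ (Finset.univ.filter (fun i => ¬ d i = 1)).filter (fun i => lab i = 0),
          (d i : ℝ) * ‖(A i * B i * C i).trace‖
        ≤ ∑ i ∈ (Finset.univ.filter (fun i => ¬ d i = 1)).filter (fun i => lab i = 0),
            K * (Real.sqrt (d i * ((B i)ᴴ * B i).trace.re) *
              Real.sqrt (d i * ((C i)ᴴ * C i).trace.re)) :=
          Finset.sum_le_sum fun i hi =>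
            h5 i (Finset.mem_filter.1 (Finset.mem_filter.1 hi).1).2 (Finset.mem_filter.1 hi).2
      _ ≤ ∑ i, K * (Real.sqrt (d i * ((B i)ᴴ * B i).trace.re) *
            Real.sqrt (d i * ((C i)ᴴ * C i).trace.re)) :=
          Finset.sum_le_univ_sum_of_nonneg fun i => by positivity
      _ = K * ∑ i, Real.sqrt (d i * ((B i)ᴴ * B i).trace.re) *
            Real.sqrt (d i * ((C i)ᴴ * C i).trace.re) := by
          rw [Finset.mul_sum]
      _ ≤ K * (Real.sqrt (∑ i, (d i : ℝ) * ((B i)ᴴ * B i).trace.re) *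
            Real.sqrt (∑ i, (d i : ℝ) * ((C i)ᴴ * C i).trace.re)) := by
          gcongr
          exact Real.sum_sqrt_mul_sqrt_le _
            (fun i => mul_nonneg (Nat.cast_nonneg _)
              (re_trace_conjTranspose_mul_self_nonneg _))
            (fun i => mul_nonneg (Nat.cast_nonneg _)
              (re_trace_conjTranspose_mul_self_nonneg _))
      _ = K * (Real.sqrt (cG * (T.card * U.card)) * Real.sqrt (cG * (U.card * S.card))) := by
          rw [h2B, h2C]
  -- the high error term equals `V |G| √|G| / √D`
  have hErr : K * (Real.sqrt (cG * (T.card * U.card)) * Real.sqrt (cG * (U.card * S.card))) =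
      V * (cG * Real.sqrt cG / Real.sqrt D) := by
    have hG0 : 0 ≤ cG := Nat.cast_nonneg _
    have hS' : (0 : ℝ) ≤ S.card := Nat.cast_nonneg _
    have hT' : (0 : ℝ) ≤ T.card := Nat.cast_nonneg _
    have hU' : (0 : ℝ) ≤ U.card := Nat.cast_nonneg _
    rw [hK, Real.sqrt_div (by positivity), Real.sqrt_mul hG0, Real.sqrt_mul hG0, Real.sqrt_mul hG0,
      Real.sqrt_mul hS', Real.sqrt_mul hT', Real.sqrt_mul hU', hV]
    push_cast
    have eG := Real.mul_self_sqrt hG0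
    have eS := Real.mul_self_sqrt hS'
    have eT := Real.mul_self_sqrt hT'
    have eU := Real.mul_self_sqrt hU'
    calc Real.sqrt cG * (Real.sqrt S.card * Real.sqrt T.card) / Real.sqrt D *
          (Real.sqrt cG * (Real.sqrt T.card * Real.sqrt U.card) *
            (Real.sqrt cG * (Real.sqrt U.card * Real.sqrt S.card)))
        = (Real.sqrt S.card * Real.sqrt S.card) * (Real.sqrt T.card * Real.sqrt T.card) *
            (Real.sqrt U.card * Real.sqrt U.card) *
            ((Real.sqrt cG * Real.sqrt cG) * Real.sqrt cG / Real.sqrt D) := by ring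
      _ = S.card * T.card * U.card * (cG * Real.sqrt cG / Real.sqrt D) := by rw [eG, eS, eT, eU]
  -- (6) LOW blocks: label `m ≠ 0`, `dᵢ ≤ N m`; per block
  -- `dᵢ |Re tr(Aᵢ Bᵢ Cᵢ)| ≤ N (lab i) ‖aᵢ‖² ‖tᵢ‖² ‖uᵢ‖²`
  have h6 : ∀ i, lab i ≠ 0 → (d i : ℝ) * |(A i * B i * C i).trace.re| ≤
      N (lab i) * (((a i)ᴴ * a i).trace.re * ((t i)ᴴ * t i).trace.re *
        ((u i)ᴴ * u i).trace.re) := by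
    intro i hli
    have hα := re_trace_conjTranspose_mul_self_nonneg (a i)
    have hτ := re_trace_conjTranspose_mul_self_nonneg (t i)
    have hυ := re_trace_conjTranspose_mul_self_nonneg (u i)
    -- `‖xᴴ y‖²_F ≤ ‖x‖²_F ‖y‖²_F`
    have hsub : ∀ x y : Matrix (Fin (d i)) (Fin (d i)) ℂ,
        ((xᴴ * y)ᴴ * (xᴴ * y)).trace.re ≤ (xᴴ * x).trace.re * (yᴴ * y).trace.re := fun x y => by
      have h := re_trace_conjTranspose_mul_self_mul_le xᴴ y
      rwa [Matrix.conjTranspose_conjTranspose, Matrix.trace_mul_comm x xᴴ] at h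
    have hAA : ((A i)ᴴ * A i).trace.re ≤ ((a i)ᴴ * a i).trace.re * ((t i)ᴴ * t i).trace.re :=
      hsub (a i) (t i)
    have hBB : ((B i)ᴴ * B i).trace.re ≤ ((t i)ᴴ * t i).trace.re * ((u i)ᴴ * u i).trace.re :=
      hsub (t i) (u i)
    have hCC : ((C i)ᴴ * C i).trace.re ≤ ((u i)ᴴ * u i).trace.re * ((a i)ᴴ * a i).trace.re :=
      hsub (u i) (a i)
    have key : ‖(A i * B i * C i).trace‖ ≤
        ((a i)ᴴ * a i).trace.re * ((t i)ᴴ * t i).trace.re * ((u i)ᴴ * u i).trace.re := by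
      refine (norm_trace_mul_mul_le _ _ _).trans ?_
      refine (mul_le_mul (Real.sqrt_le_sqrt hAA) (mul_le_mul (Real.sqrt_le_sqrt hBB)
        (Real.sqrt_le_sqrt hCC) (Real.sqrt_nonneg _) (Real.sqrt_nonneg _)) (by positivity)
        (Real.sqrt_nonneg _)).trans (le_of_eq ?_)
      rw [Real.sqrt_mul hα, Real.sqrt_mul hτ, Real.sqrt_mul hυ]
      have eα := Real.mul_self_sqrt hα
      have eτ := Real.mul_self_sqrt hτ
      have eυ := Real.mul_self_sqrt hυ
      calc Real.sqrt ((a i)ᴴ * a i).trace.re * Real.sqrt ((t i)ᴴ * t i).trace.re *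
            (Real.sqrt ((t i)ᴴ * t i).trace.re * Real.sqrt ((u i)ᴴ * u i).trace.re *
              (Real.sqrt ((u i)ᴴ * u i).trace.re * Real.sqrt ((a i)ᴴ * a i).trace.re))
          = (Real.sqrt ((a i)ᴴ * a i).trace.re * Real.sqrt ((a i)ᴴ * a i).trace.re) *
              (Real.sqrt ((t i)ᴴ * t i).trace.re * Real.sqrt ((t i)ᴴ * t i).trace.re) *
              (Real.sqrt ((u i)ᴴ * u i).trace.re * Real.sqrt ((u i)ᴴ * u i).trace.re) := by
            ring
        _ = ((a i)ᴴ * a i).trace.re * ((t i)ᴴ * t i).trace.re * ((u i)ᴴ * u i).trace.re := by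
            rw [eα, eτ, eυ]
    calc (d i : ℝ) * |(A i * B i * C i).trace.re| ≤ (d i) * ‖(A i * B i * C i).trace‖ :=
          mul_le_mul_of_nonneg_left (Complex.abs_re_le_norm _) (Nat.cast_nonneg _)
      _ ≤ (d i) * (((a i)ᴴ * a i).trace.re * ((t i)ᴴ * t i).trace.re *
            ((u i)ᴴ * u i).trace.re) := mul_le_mul_of_nonneg_left key (Nat.cast_nonneg _)
      _ ≤ N (lab i) * (((a i)ᴴ * a i).trace.re * ((t i)ᴴ * t i).trace.re *
            ((u i)ᴴ * u i).trace.re) :=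
          mul_le_mul_of_nonneg_right (hN i hli) (mul_nonneg (mul_nonneg hα hτ) hυ)
  -- summing (6) over the label-`m` family: `≤ V² N m F m S F m T F m U`
  have h7 : ∀ m, m ≠ 0 →
      ∑ i ∈ ((Finset.univ.filter (fun i => ¬ d i = 1)).filter (fun i => ¬ lab i = 0)).filter
          (fun i => lab i = m), (d i : ℝ) * |(A i * B i * C i).trace.re| ≤
        (V : ℝ) ^ 2 * (N m * (F m S * F m T * F m U)) := by
    intro m hm
    have hFS := hF m hm S
    have hFT := hF m hm T
    have hFU := hF m hm U
    have hsum0 : ∀ X : Finset G, 0 ≤ ∑ i ∈ Finset.univ.filter (fun i => lab i = m),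
        ((φ (indicatorElem ℂ X) i)ᴴ * φ (indicatorElem ℂ X) i).trace.re := fun X =>
      Finset.sum_nonneg fun i _ => re_trace_conjTranspose_mul_self_nonneg _
    calc ∑ i ∈ ((Finset.univ.filter (fun i => ¬ d i = 1)).filter (fun i => ¬ lab i = 0)).filter
            (fun i => lab i = m), (d i : ℝ) * |(A i * B i * C i).trace.re|
        ≤ ∑ i ∈ ((Finset.univ.filter (fun i => ¬ d i = 1)).filter (fun i => ¬ lab i = 0)).filter
            (fun i => lab i = m), N m * (((a i)ᴴ * a i).trace.re * ((t i)ᴴ * t i).trace.re *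
              ((u i)ᴴ * u i).trace.re) :=
          Finset.sum_le_sum fun i hi => by
            have hli : lab i = m := (Finset.mem_filter.1 hi).2
            have h := h6 i (hli ▸ hm)
            rwa [hli] at h
      _ ≤ ∑ i ∈ Finset.univ.filter (fun i => lab i = m),
            N m * (((a i)ᴴ * a i).trace.re * ((t i)ᴴ * t i).trace.re *
              ((u i)ᴴ * u i).trace.re) :=
          Finset.sum_le_sum_of_subset_of_nonneg
            (fun i hi => Finset.mem_filter.2 ⟨Finset.mem_univ _, (Finset.mem_filter.1 hi).2⟩)
            fun i _ _ => mul_nonneg (hN0 m) (mul_nonneg (mul_nonneg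
              (re_trace_conjTranspose_mul_self_nonneg _) (re_trace_conjTranspose_mul_self_nonneg _))
              (re_trace_conjTranspose_mul_self_nonneg _))
      _ = N m * ∑ i ∈ Finset.univ.filter (fun i => lab i = m),
            ((a i)ᴴ * a i).trace.re * ((t i)ᴴ * t i).trace.re * ((u i)ᴴ * u i).trace.re := by
          rw [Finset.mul_sum]
      _ ≤ N m * ((∑ i ∈ Finset.univ.filter (fun i => lab i = m), ((a i)ᴴ * a i).trace.re) *
            (∑ i ∈ Finset.univ.filter (fun i => lab i = m), ((t i)ᴴ * t i).trace.re) *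
            (∑ i ∈ Finset.univ.filter (fun i => lab i = m), ((u i)ᴴ * u i).trace.re)) :=
          mul_le_mul_of_nonneg_left (stub_blockTruncation_sum_mul_mul_le _ _ _ _
            (fun i _ => re_trace_conjTranspose_mul_self_nonneg _)
            (fun i _ => re_trace_conjTranspose_mul_self_nonneg _)
            (fun i _ => re_trace_conjTranspose_mul_self_nonneg _)) (hN0 m)
      _ ≤ N m * (((S.card : ℝ) ^ 2 * F m S) * ((T.card : ℝ) ^ 2 * F m T) *
            ((U.card : ℝ) ^ 2 * F m U)) :=
          mul_le_mul_of_nonneg_left (mul_le_mul (mul_le_mul hFS hFT (hsum0 T)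
            (mul_nonneg (by positivity) (hF0 m S))) hFU (hsum0 U)
            (mul_nonneg (mul_nonneg (by positivity) (hF0 m S))
              (mul_nonneg (by positivity) (hF0 m T)))) (hN0 m)
      _ = (V : ℝ) ^ 2 * (N m * (F m S * F m T * F m U)) := by
          rw [hV]
          push_cast
          ring
  -- summing the low families over `m = 1, …, M`
  have hlow : ∑ i ∈ (Finset.univ.filter (fun i => ¬ d i = 1)).filter (fun i => ¬ lab i = 0),
      (d i : ℝ) * |(A i * B i * C i).trace.re| ≤
        (V : ℝ) ^ 2 * ∑ m ∈ Finset.Ico 1 (M + 1), N m * (F m S * F m T * F m U) := by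
    have hmaps : ∀ i ∈ (Finset.univ.filter (fun i => ¬ d i = 1)).filter (fun i => ¬ lab i = 0),
        lab i ∈ Finset.Ico 1 (M + 1) := fun i hi =>
      Finset.mem_Ico.2 ⟨Nat.pos_of_ne_zero (Finset.mem_filter.1 hi).2, Nat.lt_succ_of_le (hlab i)⟩
    rw [← Finset.sum_fiberwise_of_maps_to hmaps, Finset.mul_sum]
    exact Finset.sum_le_sum fun m hm => h7 m (Nat.one_le_iff_ne_zero.1 (Finset.mem_Ico.1 hm).1)
  -- (7) assemble: `|G| V ≥ V² − V |G|^{3/2}/√D − V² Σ_m N m F F F`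
  have hsplit := Finset.sum_filter_add_sum_filter_not Finset.univ (fun i => d i = 1)
    (fun i => (d i : ℝ) * (A i * B i * C i).trace.re)
  have hsplit2 := Finset.sum_filter_add_sum_filter_not (Finset.univ.filter (fun i => ¬ d i = 1))
    (fun i => lab i = 0) (fun i => (d i : ℝ) * (A i * B i * C i).trace.re)
  have hpos : (V : ℝ) ^ 2 ≤ ∑ i ∈ Finset.univ.filter (fun i => d i = 1),
      (d i : ℝ) * (A i * B i * C i).trace.re := by
    rw [← h3]
    exact Finset.single_le_sum (f := fun i => (d i : ℝ) * (A i * B i * C i).trace.re)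
      (fun i hi => h4 i (Finset.mem_filter.1 hi).2) (Finset.mem_filter.2 ⟨Finset.mem_univ _, hdi₀⟩)
  have hnegH : -(K * (Real.sqrt (cG * (T.card * U.card)) * Real.sqrt (cG * (U.card * S.card)))) ≤
      ∑ i ∈ (Finset.univ.filter (fun i => ¬ d i = 1)).filter (fun i => lab i = 0),
        (d i : ℝ) * (A i * B i * C i).trace.re := by
    refine (neg_le_neg h5sum).trans ?_
    rw [← Finset.sum_neg_distrib]
    refine Finset.sum_le_sum fun i _ => ?_
    rw [← mul_neg]
    exact mul_le_mul_of_nonneg_left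
      ((neg_le_neg (Complex.abs_re_le_norm _)).trans (neg_abs_le _)) (Nat.cast_nonneg _)
  have hnegL : -((V : ℝ) ^ 2 * ∑ m ∈ Finset.Ico 1 (M + 1), N m * (F m S * F m T * F m U)) ≤
      ∑ i ∈ (Finset.univ.filter (fun i => ¬ d i = 1)).filter (fun i => ¬ lab i = 0),
        (d i : ℝ) * (A i * B i * C i).trace.re := by
    refine (neg_le_neg hlow).trans ?_
    rw [← Finset.sum_neg_distrib]
    refine Finset.sum_le_sum fun i _ => ?_
    rw [← mul_neg]
    exact mul_le_mul_of_nonneg_left (neg_abs_le _) (Nat.cast_nonneg _)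
  have hmain : (V : ℝ) ^ 2 - V * (cG * Real.sqrt cG / Real.sqrt D) -
      (V : ℝ) ^ 2 * ∑ m ∈ Finset.Ico 1 (M + 1), N m * (F m S * F m T * F m U) ≤ cG * V := by
    rw [h1, ← hsplit, ← hsplit2, ← hErr]
    linarith
  -- conclude
  have hGpos : (0 : ℝ) < cG := by rw [hcG]; exact_mod_cast Fintype.card_pos
  rw [rpow_three_halves hGpos]
  have e : cG * Real.sqrt cG * (V : ℝ) / Real.sqrt D = V * (cG * Real.sqrt cG / Real.sqrt D) := by
    ring
  linarith

end Summit.MatrixMultiplication.MatrixMultiplication.Theorems.GlobalBranch
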